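import Summits.NavierStokesRegularity.NavierStokesRegularity.Theorems.ClockStretchingLawClockCeilingLerayFloor
import Summits.NavierStokesRegularity.NavierStokesRegularity.Theorems.ClockStretchingLawClockCeilingOpenSetVorticityLiouville
import Summits.NavierStokesRegularity.NavierStokesRegularity.Theorems.SqueezeCycleSingularZoomExtraction
import Summits.NavierStokesRegularity.NavierStokesRegularity.Theorems.SqueezeCycleExtremalElementExistsRescale
import Literature.Analysis.FluidPDE.DirectionDissipation
import Literature.Analysis.FluidPDE.TaoEnstrophyLocalisation
import Literature.Analysis.FluidPDE.TypeIAncientMild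
import HarnessLib

/-!
# Route ClockStretchingLaw, crux `ClockCeiling` (stmt-NavierStokesRegularity-10570), line `registered` —
# portrait clause: the class-uniform FAR-PAST VORTICITY FLOOR of nonzero Type-I ancient mild fields

`stub_farPastVorticityFloor`: for every Type-I constant `C` there is `η = η(C) > 0` such that every
NONZERO element `u` of the Type-I ancient mild class `A_C` (`IsTypeIAncientMild C u`: jointly smooth
on `t < 0`, divergence free, KNSS/Oseen mild between all pairs `s < t < 0`, `‖u(t,x)‖ ≤ C/√(−t)`)
satisfies, on a whole far end `t < T`, `sup_x (−t)‖ω(t, x)‖ ≥ η` — the vorticity analogue of the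
universal far-past amplitude floor `farPastAmplitudeFloor` (`√(−t)‖u(t)‖_∞ > 1/(32C₀)` on a far
end). The constant `η(C)` comes from compactness and is not explicit.

## Proof (contradiction + zoom-out + compactness)

If not, there are nonzero `u_k ∈ A_C` whose gauge vorticity `(−t)‖ω_k(t, ·)‖_∞ < 1/(k+1)` along a
sequence of times `t → −∞`. By `farPastAmplitudeFloor` pick such a time `t_k` on the far end where
`u_k` is above the Leray floor at some point `x_k`: `√(−t_k)‖u_k(t_k, x_k)‖ > 1/(32C₀)`. The
Navier–Stokes zoom `v_k(s, y) = c_k u_k(c_k² s, x_k + c_k y)`, `c_k = √(−t_k)`, is again in `A_C`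
(`isTypeIAncientMild_zoom`) with `‖v_k(−1, 0)‖ = √(−t_k)‖u_k(t_k, x_k)‖ > 1/(32C₀)` and
`‖curl v_k(−1, y)‖ = (−t_k)‖ω_k(t_k, x_k + c_k y)‖ < 1/(k+1)` (`curl_smul_stPull`)
(`farPastVorticityFloor_zoom`). KNSS compactness of the class on growing windows
(`exists_tendsto_of_typeI_seq_Ioo`) extracts a limit `W ∈ A_C` with pointwise convergence of values
and gradients at `t = −1`: `‖W(−1, 0)‖ ≥ 1/(32C₀) > 0` while `curl W(−1, ·) ≡ 0` (continuity of
`curlCLM`). One irrotational slice kills a class element (`irrotationalSliceLiouville`, KNSS 2009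
Lemma 3.1 + Remark 6.1): `W ≡ 0` — contradiction.

## References

* G. Koch, N. Nadirashvili, G. Seregin, V. Šverák, *Liouville theorems for the Navier–Stokes
  equations and applications*, Acta Math. 203 (2009) 83–105 = arXiv:0709.3599, §1 (1.2),
  Lemma 3.1, Prop. 4.1, Remark 6.1. [KochNadirashviliSereginSverak2009]
* J. Leray, *Sur le mouvement d'un liquide visqueux emplissant l'espace*, Acta Math. 63 (1934),
  §19–20. [Leray1934]
-/

noncomputable section

-- the summit and its single sub-problem share the name (CONVENTIONS §1), as in every Theorems file
set_option linter.dupNamespace false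

namespace Summit.NavierStokesRegularity.NavierStokesRegularity.Theorems

open MeasureTheory Set Function Filter Topology
open Literature.Analysis Literature.Analysis.FluidPDE

section FarPastVorticityFloor

variable {C : ℝ} {u : ℝ → EuclideanSpace ℝ (Fin 3) → EuclideanSpace ℝ (Fin 3)}

/-- **The Navier–Stokes zoom-out to unit scale.** For `u ∈ A_C`, `t < 0` and a centre `x`, the zoom
`v(s, y) = c u(c² s, x + c y)`, `c = √(−t)`, is an element of `A_C` (`isTypeIAncientMild_zoom`,
KNSS 2009 §1 (1.2)) with `‖v(−1, 0)‖ = √(−t)‖u(t, x)‖` and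
`‖curl v(−1, y)‖ = (−t)‖curl u(t, x + c y)‖` (`curl_smul_stPull`).
[cite: KochNadirashviliSereginSverak2009, §1 (1.2) (arXiv:0709.3599 p. 2)] -/
theorem farPastVorticityFloor_zoom (hu : IsTypeIAncientMild C u) {t : ℝ} (ht : t < 0)
    (x : EuclideanSpace ℝ (Fin 3)) :
    ∃ v : ℝ → EuclideanSpace ℝ (Fin 3) → EuclideanSpace ℝ (Fin 3), IsTypeIAncientMild C v ∧
      ‖v (-1) 0‖ = Real.sqrt (-t) * ‖u t x‖ ∧
      ∀ y, ‖curl (v (-1)) y‖ = (-t) * ‖curl (u t) (x + Real.sqrt (-t) • y)‖ := by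
  set c : ℝ := Real.sqrt (-t) with hcdef
  have hc : 0 < c := Real.sqrt_pos.2 (neg_pos.2 ht)
  have hc2 : c ^ 2 = -t := Real.sq_sqrt (neg_pos.2 ht).le
  have ht1 : 0 + c ^ 2 * (-1) = t := by rw [hc2]; ring
  refine ⟨c • stPull (c ^ 2) c 0 x u, isTypeIAncientMild_zoom hu hc x, ?_, fun y => ?_⟩
  · show ‖c • u (0 + c ^ 2 * (-1)) (x + c • (0 : EuclideanSpace ℝ (Fin 3)))‖ = c * ‖u t x‖
    rw [ht1, smul_zero, add_zero, norm_smul, Real.norm_of_nonneg hc.le]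
  · rw [curl_smul_stPull, ht1, norm_smul, Real.norm_of_nonneg (mul_pos hc hc).le, ← sq, hc2]

/-- **The class-uniform far-past vorticity floor of nonzero Type-I ancient mild fields.** For every
`C` there is `η > 0` such that every nonzero `u ∈ A_C` has, on a whole far end `t < T < 0`, a point
`x` with `(−t)‖curl u(t, x)‖ ≥ η`. By contradiction: zoom out nonzero elements with far-past
vorticity `< 1/(k+1)` at far-past times above the Leray floor (`farPastAmplitudeFloor`,
`farPastVorticityFloor_zoom`), extract a limit in the class (`exists_tendsto_of_typeI_seq_Ioo`)
which is nonzero at `(−1, 0)` but irrotational at `t = −1`, against `irrotationalSliceLiouville`.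
[cite: KochNadirashviliSereginSverak2009, Lemma 3.1, Prop. 4.1 and Remark 6.1 (arXiv:0709.3599)] -/
theorem farPastVorticityFloor (C : ℝ) :
    ∃ η > 0, ∀ u : ℝ → EuclideanSpace ℝ (Fin 3) → EuclideanSpace ℝ (Fin 3), IsTypeIAncientMild C u →
      (∃ t < 0, ∃ x, u t x ≠ 0) → ∃ T < 0, ∀ t < T, ∃ x, η ≤ (-t) * ‖curl (u t) x‖ := by
  by_contra h
  push Not at h
  -- nonzero elements whose gauge vorticity is `< 1/(n+1)` along a sequence of times `t → -∞`
  have hseq : ∀ n : ℕ, ∃ u : ℝ → EuclideanSpace ℝ (Fin 3) → EuclideanSpace ℝ (Fin 3),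
      IsTypeIAncientMild C u ∧ (∃ t < 0, ∃ x, u t x ≠ 0) ∧
      ∀ T < 0, ∃ t < T, ∀ x, (-t) * ‖curl (u t) x‖ < 1 / ((n : ℝ) + 1) := fun n =>
    h _ Nat.one_div_pos_of_nat
  choose u hu hne hsmall using hseq
  -- far-past times above the Leray floor with small vorticity
  have hpick : ∀ n : ℕ, ∃ t < 0, ∃ x : EuclideanSpace ℝ (Fin 3),
      1 < 32 * oseenSliceConst (EuclideanSpace ℝ (Fin 3)) * (Real.sqrt (-t) * ‖u n t x‖) ∧
      ∀ y, (-t) * ‖curl (u n t) y‖ < 1 / ((n : ℝ) + 1) := by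
    intro n
    obtain ⟨T, hT, hfloor⟩ := farPastAmplitudeFloor (hu n) (hne n)
    obtain ⟨t, ht, hsm⟩ := hsmall n T hT
    obtain ⟨x, hx⟩ := hfloor t ht
    exact ⟨t, ht.trans hT, x, hx, hsm⟩
  choose t ht x hx hsm using hpick
  -- zoom out to unit scale around the floor points
  choose v hv hv0 hvcurl using fun n => farPastVorticityFloor_zoom (hu n) (ht n) (x n)
  -- compactness on the growing windows `(-(k+1), 0)`
  set A : ℕ → ℝ := fun k => -((k : ℝ) + 1)
  have hAt : Tendsto A atTop atBot :=
    tendsto_neg_atTop_atBot.comp (tendsto_natCast_atTop_atTop.atTop_add tendsto_const_nhds)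
  have hcont : ∀ k, ContinuousOn (uncurry (v k)) (Ioo (A k) 0 ×ˢ univ) := fun k =>
    (hv k).continuousOn_uncurry.mono (prod_mono (fun t ht => ht.2) subset_rfl)
  have hdivw : ∀ k, ∀ t ∈ Ioo (A k) 0, IsWeaklyDivFree (v k t) := fun k t ht =>
    (hv k).isWeaklyDivFree ht.2
  have hmild : ∀ k, ∀ s t : ℝ, A k < s → s < t → t < 0 → ∀ x,
      v k t x = UnboundedOperators.heatExtension (v k s) (t - s) x -
        oseenDuhamel 1 s (v k) (v k) t x :=
    fun k s t _ hst ht x => (hv k).mild_eq_heatExtension hst ht x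
  have hI : ∀ k, ∀ t ∈ Ioo (A k) 0, ∀ x, ‖v k t x‖ ≤ C / Real.sqrt (-t) := fun k t ht x =>
    (hv k).norm_le ht.2 x
  obtain ⟨φ, hφ, W, hW, hpt, hptG, -, -⟩ :=
    exists_tendsto_of_typeI_seq_Ioo C hAt hcont hdivw hmild hI
  -- the limit is above the Leray floor at `(-1, 0)`
  have hW0 : 1 ≤ 32 * oseenSliceConst (EuclideanSpace ℝ (Fin 3)) * ‖W (-1) 0‖ := by
    have hconv : Tendsto (fun j => 32 * oseenSliceConst (EuclideanSpace ℝ (Fin 3)) *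
        ‖v (φ j) (-1) 0‖) atTop (𝓝 (32 * oseenSliceConst (EuclideanSpace ℝ (Fin 3)) *
          ‖W (-1) 0‖)) :=
      ((hpt (-1) (by norm_num) 0).norm).const_mul _
    refine ge_of_tendsto hconv (Eventually.of_forall fun j => ?_)
    have := hx (φ j)
    rw [← hv0 (φ j)] at this
    exact this.le
  -- its vorticity at `-1` is the limit of the vorticities, hence zero
  have hcurlW : ∀ y, curl (W (-1)) y = 0 := by
    intro y
    have hconv : Tendsto (fun j => curl (v (φ j) (-1)) y) atTop (𝓝 (curl (W (-1)) y)) := by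
      simp only [curl_eq_curlCLM]
      exact (curlCLM.continuous.tendsto _).comp (hptG (-1) (by norm_num) y)
    have hb : Tendsto (fun j : ℕ => 1 / ((φ j : ℝ) + 1)) atTop (𝓝 0) :=
      (tendsto_one_div_add_atTop_nhds_zero_nat (𝕜 := ℝ)).comp hφ.tendsto_atTop
    have hle : ‖curl (W (-1)) y‖ ≤ 0 :=
      le_of_tendsto_of_tendsto' hconv.norm hb fun j => by
        have := hsm (φ j) (x (φ j) + Real.sqrt (-t (φ j)) • y)
        rw [← hvcurl (φ j)] at this
        exact this.le
    exact norm_le_zero_iff.1 hle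
  -- one irrotational slice kills the limit: contradiction with the floor at `(-1, 0)`
  have hWz : W (-1) 0 = 0 := irrotationalSliceLiouville hW (by norm_num : (-1 : ℝ) < 0) hcurlW
    (-1) (by norm_num) 0
  rw [hWz, norm_zero, mul_zero] at hW0
  exact absurd hW0 (by norm_num)

end FarPastVorticityFloor

/-- **Stub `stub_farPastVorticityFloor` (crux stmt-NavierStokesRegularity-10570, line `registered`,
portrait clause)**: the class-uniform far-past VORTICITY floor of NONZERO elements of the Type-I
ancient mild class — for every `C` there is `η > 0` such that every nonzero `u` with
`IsTypeIAncientMild C u` has, on a whole far end `t < T`, a point with `(−t)‖curl u(t, x)‖ ≥ η`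
(zoom-out along the far-past amplitude floor + KNSS compactness + one irrotational slice kills a
class element; `farPastVorticityFloor`).
[cite: KochNadirashviliSereginSverak2009, Lemma 3.1, Prop. 4.1 and Remark 6.1 (arXiv:0709.3599)] -/
theorem stub_farPastVorticityFloor : ∀ C : ℝ, ∃ η > 0, ∀ u : ℝ → EuclideanSpace ℝ (Fin 3) → EuclideanSpace ℝ (Fin 3), Literature.Analysis.FluidPDE.IsTypeIAncientMild C u → (∃ t < 0, ∃ x, u t x ≠ 0) → ∃ T < 0, ∀ t < T, ∃ x, η ≤ (-t) * ‖Literature.Analysis.FluidPDE.curl (u t) x‖ :=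
  fun C => farPastVorticityFloor C

end Summit.NavierStokesRegularity.NavierStokesRegularity.Theorems

end
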